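import Literature.Probability.RandomPlanarGeometry.LoopDistanceParametrisation
import Literature.Probability.RandomPlanarGeometry.CurveMonotoneReparam
import HarnessLib

/-!
# Loop gluing: from arc-wise reparametrisation bounds to `Curve.loopDist` / `UnbasedLoop.udist` bounds

Crux `Summit.CriticalPhenomena.CardyFormulaZ2.Theses.CardyMagicRigidity.NestingRigidity`
(stmt-CriticalPhenomena-4835), line `pinch-resampling` v3, brick B5 of the transfer stub S10
`stub_neckTomography` (lattice-free, deterministic metric geometry of curves).

After no-neck rigidity (stub S9, `NoNeckRigidity`) has been applied free arc by free arc, the transfer holds, for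
a macroscopic loop `α` of one configuration and its partner `β` of the other, cut points
`0 = τ₀ ≤ τ₁ ≤ ⋯ ≤ τ_k = 1` of `α` and `0 = τ'₀ ≤ ⋯ ≤ τ'_k = 1` of a re-based copy `β.shift b` of `β`, and for
every cell a bound `reparamDist (arc of α over [τ_i, τ_{i+1}]) (arc of β.shift b over [τ'_i, τ'_{i+1}]) ≤ η`
(arcs affinely reparametrised by `[0, 1]`, `arcOf`).  This file glues such cell-wise bounds:

* §1 monotone matchings — the arcs `α|[a,b]`, `β|[a',b']` admit a COMMON monotone (not necessarily strictly monotone)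
  continuous parametrisation along which they stay within `η` (a displayed existential, no new predicate); monotone
  re-timings are at reparametrisation distance `0` (`reparamDist_precomp_eq_zero`, from
  `Curve.reparamDist_eq_zero_of_monotone'`), so a matching of the whole curves bounds the based distance
  (`reparamDist_le_of_arcMatched`, the registered anchor); matchings of consecutive arcs concatenate (`arcMatched_append`, `arcMatched_chain`).
* §2 the affine sub-arc `arcOf α a b` and `arcMatched_of_reparamDist_arcOf_lt`: a strict bound on the
  reparametrisation distance of two sub-arcs is a matching.
* §3 the gluing theorems: `reparamDist_le_of_reparamDist_arcs` (based), `loopDist_le_of_reparamDist_arcs`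
  (unbased oriented, the partner re-based by `Curve.shift`), and the passage to DKKMO's
  unoriented distance of unbased loops `udist_mk_mk_le_of_loopDist_le` / `udist_mk_mk_le_of_loopDist_reverse_le`
  (either orientation of the partner), which is what `LoopConfig.IsClose` consumes.
-/

noncomputable section

namespace Summit.CriticalPhenomena.CardyFormulaZ2.Cruxes.NestingRigidity.PinchResampling

open Set unitInterval Literature.Probability.RandomPlanarGeometry

/-! ## §1 Monotone matchings of arcs -/

section Matching

variable {E : Type*} [PseudoMetricSpace E]

/-! **Monotone matchings.**  Throughout, "the arc of `α` from `a` to `b` and the arc of `β` from `a'` to `b'` are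
MONOTONICALLY MATCHED at precision `η`" is the displayed existential
`∃ u v : I → I, Continuous u ∧ Continuous v ∧ Monotone u ∧ Monotone v ∧ u 0 = a ∧ u 1 = b ∧ v 0 = a' ∧ v 1 = b' ∧
∀ s, dist (α (u s)) (β (v s)) ≤ η`: a common continuous monotone (not necessarily strictly monotone — pauses on either
side are allowed, which is what makes matchings concatenate) parametrisation by `[0, 1]` along which the two curves stay
within `η`.  It is written out in every statement (no new predicate is introduced). -/

/-- **A monotone re-timing is at reparametrisation distance `0`**: for `u : [0,1] → [0,1]` continuous and
monotone with `u 0 = 0`, `u 1 = 1`, the curve `α ∘ u` is at `reparamDist` `0` from `α` (two monotone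
traversals of the arc `α`, `Curve.reparamDist_eq_zero_of_monotone'`). -/
theorem reparamDist_precomp_eq_zero (α : Curve E) {u : I → I} (huc : Continuous u) (hum : Monotone u)
    (hu0 : u 0 = 0) (hu1 : u 1 = 1) :
    Curve.reparamDist ⟨α.toContinuousMap.comp ⟨u, huc⟩⟩ α = 0 := by
  have hp0 : projIcc (0 : ℝ) 1 zero_le_one 0 = 0 := Subtype.ext (by simp [projIcc])
  have hp1 : projIcc (0 : ℝ) 1 zero_le_one 1 = 1 := Subtype.ext (by simp [projIcc])
  refine Curve.reparamDist_eq_zero_of_monotone' (m := 1) zero_le_one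
    (V := fun x ↦ α (projIcc 0 1 zero_le_one x))
    (h₁ := fun x ↦ (u (projIcc 0 1 zero_le_one x) : ℝ)) (h₂ := fun x ↦ (projIcc 0 1 zero_le_one x : ℝ))
    (α.continuous.comp (continuous_projIcc (h := zero_le_one))).continuousOn
    (continuous_subtype_val.comp (huc.comp (continuous_projIcc (h := zero_le_one))))
    (continuous_subtype_val.comp (continuous_projIcc (h := zero_le_one)))
    (fun x y hxy ↦ Subtype.coe_le_coe.2 (hum (monotone_projIcc zero_le_one hxy)))
    (fun x y hxy ↦ Subtype.coe_le_coe.2 (monotone_projIcc zero_le_one hxy))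
    (by simp only [hp0, hu0]; rfl) (by simp only [hp0]; rfl) (by simp only [hp1, hu1]; rfl)
    (by simp only [hp1]; rfl) (fun t ↦ ?_) (fun t ↦ ?_)
  · change α (u t) = α (projIcc 0 1 zero_le_one (u (projIcc 0 1 zero_le_one (t : ℝ)) : ℝ))
    simp only [projIcc_val]
  · simp only [projIcc_val]

/-- **A matching of the whole curves bounds the based reparametrisation distance (registered anchor)**: if `α|[0,1]` and
`β|[0,1]` are monotonically matched at precision `η` then `reparamDist α β ≤ η` — insert the two re-timed
curves `α ∘ u`, `β ∘ v` (each at distance `0` from its curve) and compare them time by time. -/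
theorem reparamDist_le_of_arcMatched : ∀ {E : Type*} [PseudoMetricSpace E] {η : ℝ} {α β : Literature.Probability.RandomPlanarGeometry.Curve E}, (∃ u v : unitInterval → unitInterval, Continuous u ∧ Continuous v ∧ Monotone u ∧ Monotone v ∧ u 0 = 0 ∧ u 1 = 1 ∧ v 0 = 0 ∧ v 1 = 1 ∧ ∀ s, dist (α (u s)) (β (v s)) ≤ η) → Literature.Probability.RandomPlanarGeometry.Curve.reparamDist α β ≤ η := by
  intro E _ η α β h
  obtain ⟨u, v, huc, hvc, hum, hvm, hu0, hu1, hv0, hv1, huv⟩ := h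
  set A : Curve E := ⟨α.toContinuousMap.comp ⟨u, huc⟩⟩ with hA
  set B : Curve E := ⟨β.toContinuousMap.comp ⟨v, hvc⟩⟩ with hB
  have hAα : Curve.reparamDist α A = 0 := by
    rw [Curve.reparamDist_comm]; exact reparamDist_precomp_eq_zero α huc hum hu0 hu1
  have hBβ : Curve.reparamDist B β = 0 := reparamDist_precomp_eq_zero β hvc hvm hv0 hv1
  have hAB : Curve.reparamDist A B ≤ η := by
    refine (Curve.reparamDist_le_dist A B).trans ((ContinuousMap.dist_le (dist_nonneg.trans (huv 0))).2 ?_)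
    exact fun s ↦ huv s
  calc Curve.reparamDist α β ≤ Curve.reparamDist α A + Curve.reparamDist A β := Curve.reparamDist_triangle _ _ _
    _ ≤ Curve.reparamDist α A + (Curve.reparamDist A B + Curve.reparamDist B β) := by
        gcongr; exact Curve.reparamDist_triangle _ _ _
    _ ≤ 0 + (η + 0) := by rw [hAα, hBβ]; gcongr
    _ = η := by ring

/-- The concatenation (Mathlib `Path.trans`) of two monotone paths of `[0, 1]` is monotone. -/
theorem monotone_trans {a b c : I} (p : Path a b) (q : Path b c) (hp : Monotone p) (hq : Monotone q) :
    Monotone (p.trans q) := by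
  have hpb : ∀ x, p x ≤ b := fun x ↦ by simpa using hp (show x ≤ 1 from le_one x)
  have hbq : ∀ x, b ≤ q x := fun x ↦ by simpa using hq (show 0 ≤ x from nonneg x)
  intro s t hst
  have hst' : (s : ℝ) ≤ t := hst
  rw [Path.trans_apply, Path.trans_apply]
  split_ifs with hs ht ht
  · exact hp (Subtype.mk_le_mk.2 (by linarith))
  · exact (hpb _).trans (hbq _)
  · exact absurd (hst'.trans ht) hs
  · exact hq (Subtype.mk_le_mk.2 (by linarith))

/-- **Matchings of consecutive arcs concatenate**: a matching of `α|[a,b]` with `β|[a',b']` and one of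
`α|[b,c]` with `β|[b',c']`, both at precision `η`, give a matching of `α|[a,c]` with `β|[a',c']` (run the two
common parametrisations at double speed one after the other, `Path.trans`). -/
theorem arcMatched_append {η : ℝ} {α β : Curve E} {a b c a' b' c' : I}
    (h₁ : ∃ u v : I → I, Continuous u ∧ Continuous v ∧ Monotone u ∧ Monotone v ∧
      u 0 = a ∧ u 1 = b ∧ v 0 = a' ∧ v 1 = b' ∧ ∀ s, dist (α (u s)) (β (v s)) ≤ η)
    (h₂ : ∃ u v : I → I, Continuous u ∧ Continuous v ∧ Monotone u ∧ Monotone v ∧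
      u 0 = b ∧ u 1 = c ∧ v 0 = b' ∧ v 1 = c' ∧ ∀ s, dist (α (u s)) (β (v s)) ≤ η) :
    ∃ u v : I → I, Continuous u ∧ Continuous v ∧ Monotone u ∧ Monotone v ∧
      u 0 = a ∧ u 1 = c ∧ v 0 = a' ∧ v 1 = c' ∧ ∀ s, dist (α (u s)) (β (v s)) ≤ η := by
  obtain ⟨u₁, v₁, hu₁c, hv₁c, hu₁m, hv₁m, hu₁0, hu₁1, hv₁0, hv₁1, huv₁⟩ := h₁
  obtain ⟨u₂, v₂, hu₂c, hv₂c, hu₂m, hv₂m, hu₂0, hu₂1, hv₂0, hv₂1, huv₂⟩ := h₂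
  set p₁ : Path a b := ⟨⟨u₁, hu₁c⟩, hu₁0, hu₁1⟩ with hp₁
  set p₂ : Path b c := ⟨⟨u₂, hu₂c⟩, hu₂0, hu₂1⟩ with hp₂
  set q₁ : Path a' b' := ⟨⟨v₁, hv₁c⟩, hv₁0, hv₁1⟩ with hq₁
  set q₂ : Path b' c' := ⟨⟨v₂, hv₂c⟩, hv₂0, hv₂1⟩ with hq₂
  refine ⟨p₁.trans p₂, q₁.trans q₂, (p₁.trans p₂).continuous, (q₁.trans q₂).continuous,
    monotone_trans p₁ p₂ hu₁m hu₂m, monotone_trans q₁ q₂ hv₁m hv₂m, (p₁.trans p₂).source,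
    (p₁.trans p₂).target, (q₁.trans q₂).source, (q₁.trans q₂).target, fun s ↦ ?_⟩
  rw [Path.trans_apply, Path.trans_apply]
  split_ifs with hs
  · exact huv₁ _
  · exact huv₂ _

/-- **Chains of matchings**: matchings of the consecutive arcs `α|[τ i, τ (i+1)]`, `β|[τ' i, τ' (i+1)]`,
`i < k` (`k ≥ 1` cells), concatenate to a matching of `α|[τ 0, τ k]` with `β|[τ' 0, τ' k]`. -/
theorem arcMatched_chain {η : ℝ} {α β : Curve E} (τ τ' : ℕ → I) :
    ∀ {k : ℕ}, 0 < k →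
      (∀ i < k, ∃ u v : I → I, Continuous u ∧ Continuous v ∧ Monotone u ∧ Monotone v ∧
        u 0 = τ i ∧ u 1 = τ (i + 1) ∧ v 0 = τ' i ∧ v 1 = τ' (i + 1) ∧ ∀ s, dist (α (u s)) (β (v s)) ≤ η) →
      ∃ u v : I → I, Continuous u ∧ Continuous v ∧ Monotone u ∧ Monotone v ∧
        u 0 = τ 0 ∧ u 1 = τ k ∧ v 0 = τ' 0 ∧ v 1 = τ' k ∧ ∀ s, dist (α (u s)) (β (v s)) ≤ η
  | 0, hk, _ => absurd hk (lt_irrefl 0)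
  | 1, _, h => h 0 zero_lt_one
  | k + 2, _, h =>
    arcMatched_append (arcMatched_chain τ τ' (Nat.succ_pos k) fun i hi ↦ h i (Nat.lt_succ_of_lt hi))
      (h (k + 1) (Nat.lt_succ_self _))

end Matching

/-! ## §2 Affine sub-arcs -/

section Arc

variable {E : Type*} [PseudoMetricSpace E]

/-- The affine time change of `[0, 1]` onto the stretch from `a` to `b`: `s ↦ (1 - s) a + s b` (a point of
`[0, 1]` by convexity; decreasing when `b < a`). -/
def affTime (a b s : I) : I :=
  ⟨(1 - (s : ℝ)) * a + s * b, by
    constructor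
    · nlinarith [nonneg a, nonneg b, nonneg s, one_minus_nonneg s]
    · nlinarith [le_one a, le_one b, nonneg s, one_minus_nonneg s, nonneg a, nonneg b]⟩

/-- Coordinates of `affTime`. -/
@[simp] theorem coe_affTime (a b s : I) : (affTime a b s : ℝ) = (1 - (s : ℝ)) * a + s * b := rfl

/-- `affTime a b 0 = a`. -/
@[simp] theorem affTime_zero (a b : I) : affTime a b 0 = a := Subtype.ext (by simp)

/-- `affTime a b 1 = b`. -/
@[simp] theorem affTime_one (a b : I) : affTime a b 1 = b := Subtype.ext (by simp)

/-- `affTime a b` is continuous. -/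
theorem continuous_affTime (a b : I) : Continuous (affTime a b) :=
  Continuous.subtype_mk (by fun_prop) _

/-- `affTime a b` is monotone when `a ≤ b`. -/
theorem monotone_affTime {a b : I} (hab : a ≤ b) : Monotone (affTime a b) := by
  intro s t hst
  have hab' : (a : ℝ) ≤ b := hab
  have hst' : (s : ℝ) ≤ t := hst
  change (1 - (s : ℝ)) * a + s * b ≤ (1 - (t : ℝ)) * a + t * b
  nlinarith

/-- **The sub-arc of `α` over the stretch from `a` to `b`, affinely reparametrised by `[0, 1]`** (for `b < a`
it is the reversed sub-arc). -/
def arcOf (α : Curve E) (a b : I) : Curve E :=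
  ⟨α.toContinuousMap.comp ⟨affTime a b, continuous_affTime a b⟩⟩

/-- Pointwise formula for `Curve.arcOf`. -/
@[simp] theorem arcOf_apply (α : Curve E) (a b s : I) : arcOf α a b s = α (affTime a b s) := rfl

/-- **A strict reparametrisation bound between two sub-arcs is a matching**: if
`reparamDist (α.arcOf a b) (β.arcOf a' b') < η` with `a ≤ b`, `a' ≤ b'`, then `α|[a,b]` and `β|[a',b']` are
monotonically matched at precision `η` (extract an increasing reparametrisation `φ` realising the strict
bound, as in `Curve.exists_reparam_forall_dist_lt`, and compose it with the affine time changes). -/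
theorem arcMatched_of_reparamDist_arcOf_lt {η : ℝ} {α β : Curve E} {a b a' b' : I} (hab : a ≤ b)
    (ha'b' : a' ≤ b') (h : Curve.reparamDist (arcOf α a b) (arcOf β a' b') < η) :
    ∃ u v : I → I, Continuous u ∧ Continuous v ∧ Monotone u ∧ Monotone v ∧
      u 0 = a ∧ u 1 = b ∧ v 0 = a' ∧ v 1 = b' ∧ ∀ s, dist (α (u s)) (β (v s)) ≤ η := by
  obtain ⟨φ, hφ⟩ := exists_lt_of_ciInf_lt h
  replace hφ : ∀ s, dist (arcOf α a b s) ((arcOf β a' b').reparam φ s) < η :=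
    fun s ↦ (ContinuousMap.dist_apply_le_dist s).trans_lt hφ
  refine ⟨affTime a b, affTime a' b' ∘ φ, continuous_affTime a b,
    (continuous_affTime a' b').comp φ.toHomeomorph.continuous, monotone_affTime hab,
    (monotone_affTime ha'b').comp φ.monotone, affTime_zero a b, affTime_one a b, ?_, ?_, fun s ↦ (hφ s).le⟩
  · simp [show φ 0 = 0 from φ.map_bot]
  · simp [show φ 1 = 1 from φ.map_top]

end Arc

/-! ## §3 Gluing: cell-wise reparametrisation bounds give `reparamDist`, `loopDist` and `udist` bounds -/

section Gluing

variable {E : Type*} [PseudoMetricSpace E]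

/-- **Based gluing.**  Cut `α` at times `τ 0 = 0 ≤ τ 1 ≤ ⋯ ≤ τ k = 1` and `β` at `τ' 0 = 0 ≤ ⋯ ≤ τ' k = 1`
(`k ≥ 1`); if every pair of corresponding sub-arcs satisfies `reparamDist (α.arcOf (τ i) (τ (i+1)))
(β.arcOf (τ' i) (τ' (i+1))) ≤ η`, then `reparamDist α β ≤ η` (match every cell at any precision `η' > η`,
concatenate, and let `η' → η`). -/
theorem reparamDist_le_of_reparamDist_arcs {η : ℝ} {α β : Curve E} {k : ℕ} (hk : 0 < k) (τ τ' : ℕ → I)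
    (hτ0 : τ 0 = 0) (hτk : τ k = 1) (hτ'0 : τ' 0 = 0) (hτ'k : τ' k = 1)
    (hτ : ∀ i < k, τ i ≤ τ (i + 1)) (hτ' : ∀ i < k, τ' i ≤ τ' (i + 1))
    (h : ∀ i < k, Curve.reparamDist (arcOf α (τ i) (τ (i + 1))) (arcOf β (τ' i) (τ' (i + 1))) ≤ η) :
    Curve.reparamDist α β ≤ η := by
  refine le_of_forall_gt_imp_ge_of_dense fun η' hη' ↦ ?_
  have hc := arcMatched_chain (η := η') (α := α) (β := β) τ τ' hk fun i hi ↦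
    arcMatched_of_reparamDist_arcOf_lt (hτ i hi) (hτ' i hi) ((h i hi).trans_lt hη')
  rw [hτ0, hτk, hτ'0, hτ'k] at hc
  exact reparamDist_le_of_arcMatched hc

/-- **Loop gluing (brick B5 of stub S10).**  Let `α`, `β` be curves, `b` a change of base
point for `β`, and cut `α` and the re-based `β.shift b` into `k ≥ 1` corresponding cells as above; if every
pair of corresponding sub-arcs is at reparametrisation distance `≤ η`, then the UNBASED oriented distance
satisfies `Curve.loopDist α β ≤ η` (`loopDist ≤ reparamDist` to any re-basing, `Curve.loopDist_le'`).  This is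
the step of the transfer after no-neck rigidity has matched the free arcs and the routing has matched the
passages through the neck regions. -/
theorem loopDist_le_of_reparamDist_arcs {η : ℝ} {α β : Curve E} {k : ℕ} (hk : 0 < k) (b : ℝ) (τ τ' : ℕ → I)
    (hτ0 : τ 0 = 0) (hτk : τ k = 1) (hτ'0 : τ' 0 = 0) (hτ'k : τ' k = 1)
    (hτ : ∀ i < k, τ i ≤ τ (i + 1)) (hτ' : ∀ i < k, τ' i ≤ τ' (i + 1))
    (h : ∀ i < k, Curve.reparamDist (arcOf α (τ i) (τ (i + 1))) (arcOf (β.shift b) (τ' i) (τ' (i + 1))) ≤ η) :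
    Curve.loopDist α β ≤ η :=
  (Curve.loopDist_le' α β b).trans (reparamDist_le_of_reparamDist_arcs hk τ τ' hτ0 hτk hτ'0 hτ'k hτ hτ' h)

end Gluing

section Unbased

variable {E : Type*} [MetricSpace E]

/-- **From `loopDist` to DKKMO's `d`**: for loops `α`, `β`, a bound `Curve.loopDist α β ≤ η` bounds the
unoriented unbased distance `UnbasedLoop.udist` of their unbased loops (`udist ≤` the oriented distance,
which is `loopDist` on representatives). -/
theorem udist_mk_mk_le_of_loopDist_le {α β : Curve E} (hα : α.IsLoop) (hβ : β.IsLoop) {η : ℝ}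
    (h : Curve.loopDist α β ≤ η) :
    UnbasedLoop.udist (UnbasedLoop.mk (BasedLoop.mk (CurveClass.mk α) (CurveClass.isLoop_mk.2 hα)))
      (UnbasedLoop.mk (BasedLoop.mk (CurveClass.mk β) (CurveClass.isLoop_mk.2 hβ))) ≤ η := by
  have hd : dist (UnbasedLoop.mk (BasedLoop.mk (CurveClass.mk α) (CurveClass.isLoop_mk.2 hα)))
      (UnbasedLoop.mk (BasedLoop.mk (CurveClass.mk β) (CurveClass.isLoop_mk.2 hβ))) = Curve.loopDist α β := by
    rw [UnbasedLoop.dist_mk_mk, BasedLoop.dist_def, BasedLoop.toCurveClass_mk, BasedLoop.toCurveClass_mk,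
      CurveClass.loopDist_mk]
  exact (UnbasedLoop.udist_le_dist _ _).trans (hd.le.trans h)

/-- **The same with the partner traversed backwards**: `Curve.loopDist α β.reverse ≤ η` also bounds
`udist` (DKKMO's `d` minimises over both orientations), which is the case produced by the transfer when the
matched routing reverses the orientation of the partner loop. -/
theorem udist_mk_mk_le_of_loopDist_reverse_le {α β : Curve E} (hα : α.IsLoop) (hβ : β.IsLoop) {η : ℝ}
    (h : Curve.loopDist α β.reverse ≤ η) :
    UnbasedLoop.udist (UnbasedLoop.mk (BasedLoop.mk (CurveClass.mk α) (CurveClass.isLoop_mk.2 hα)))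
      (UnbasedLoop.mk (BasedLoop.mk (CurveClass.mk β) (CurveClass.isLoop_mk.2 hβ))) ≤ η := by
  have hd : dist (UnbasedLoop.mk (BasedLoop.mk (CurveClass.mk α) (CurveClass.isLoop_mk.2 hα)))
      (UnbasedLoop.mk (BasedLoop.mk (CurveClass.mk β) (CurveClass.isLoop_mk.2 hβ))).reverse =
        Curve.loopDist α β.reverse := by
    rw [UnbasedLoop.reverse_mk, UnbasedLoop.dist_mk_mk, BasedLoop.dist_def, BasedLoop.toCurveClass_reverse,
      BasedLoop.toCurveClass_mk, BasedLoop.toCurveClass_mk, CurveClass.reverse_mk, CurveClass.loopDist_mk]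
  exact (UnbasedLoop.udist_le_dist_reverse _ _).trans (hd.le.trans h)

/-- **Loop gluing in DKKMO's distance**: under the hypotheses of `loopDist_le_of_reparamDist_arcs` for loops
`α`, `β` (partner re-based by `b` and cut into `k ≥ 1` corresponding cells with cell-wise reparametrisation
bounds `≤ η`), `udist ≤ η` for the unbased loops — the quantity compared by `LoopConfig.IsClose`. -/
theorem udist_mk_mk_le_of_reparamDist_arcs {η : ℝ} {α β : Curve E} (hα : α.IsLoop) (hβ : β.IsLoop) {k : ℕ}
    (hk : 0 < k) (b : ℝ) (τ τ' : ℕ → I) (hτ0 : τ 0 = 0) (hτk : τ k = 1) (hτ'0 : τ' 0 = 0) (hτ'k : τ' k = 1)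
    (hτ : ∀ i < k, τ i ≤ τ (i + 1)) (hτ' : ∀ i < k, τ' i ≤ τ' (i + 1))
    (h : ∀ i < k, Curve.reparamDist (arcOf α (τ i) (τ (i + 1))) (arcOf (β.shift b) (τ' i) (τ' (i + 1))) ≤ η) :
    UnbasedLoop.udist (UnbasedLoop.mk (BasedLoop.mk (CurveClass.mk α) (CurveClass.isLoop_mk.2 hα)))
      (UnbasedLoop.mk (BasedLoop.mk (CurveClass.mk β) (CurveClass.isLoop_mk.2 hβ))) ≤ η :=
  udist_mk_mk_le_of_loopDist_le hα hβ (loopDist_le_of_reparamDist_arcs hk b τ τ' hτ0 hτk hτ'0 hτ'k hτ hτ' h)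

end Unbased

end Summit.CriticalPhenomena.CardyFormulaZ2.Cruxes.NestingRigidity.PinchResampling

end
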